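import Summits.Langlands.Langlands.Theses.DyadicCompanionSplit

/-!
# Glue of the gen-2 resplit (k = 4β form) of `DyadicCompanionExistence` (route DyadicCompanionSplit)

Closes the glue item generated by
`ledger route edit route-Langlands-DyadicCompanionSplit --resplit DyadicCompanionExistence --into [LieIrreducibleCompanion, DyadicDeRhamRigidity, ArtinTensorCore, CliffordTateShapes]
--glue-decl-name DyadicCompanionExistence_of_resplit`:
`DyadicCompanionExistence_of_resplit : LieIrreducibleCompanion → DyadicDeRhamRigidity → ArtinTensorCore → CliffordTateShapes → DyadicCompanionExistence` (binder order immaterial: the proof is `intro; apply dyadicCompanionExistence_of_cells <;> assumption`).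
Pure logic over the inlined texts: strong induction on the dimension assembles T (= the retired child `DyadicContinuousCompanion`
31993, all slices) from R (Lie-irreducible case), C♯ (Clifford–Tate shapes: induced from a smaller level-one V₁ — IH + transport —, or an Artin-tensor shape) and TF (the Artin-tensor core, fed the same IH), then G makes the continuous companion de Rham above 2 (the g8 glue).
(= decomp-langlands lens-4 g10 node `ArtinTensorCore` kernel `TensorCore.dyadicCompanionExistence_of_resplit4β`; mock-certified against
the gate render in `resplit4b_glue.mock.lean`, rc 0, axioms standard.)  No definitions, no new mathematics.
-/

set_option linter.dupNamespace false

namespace Summit.Langlands.Langlands.Theorems.DyadicCompanionSplitResplit4b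

open Filter

/-- Assembly of `DyadicCompanionExistence` from the four children of the k = 4β resplit
(strong induction on the dimension; pure logic over the inlined texts). -/
theorem dyadicCompanionExistence_of_cells (hR : Summit.Langlands.Langlands.Theses.DyadicCompanionSplit.LieIrreducibleCompanion) (hG : Summit.Langlands.Langlands.Theses.DyadicCompanionSplit.DyadicDeRhamRigidity) (hF : Summit.Langlands.Langlands.Theses.DyadicCompanionSplit.ArtinTensorCore) (hC : Summit.Langlands.Langlands.Theses.DyadicCompanionSplit.CliffordTateShapes) : Summit.Langlands.Langlands.Theses.DyadicCompanionSplit.DyadicCompanionExistence := by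
  have hT : ∀ (m : ℕ), ∀ (L : Type) [Field L] [NumberField L], 0 < m → ∀ (ℓ : ℕ) [Fact ℓ.Prime], ℓ ≠ 2 → ∀ (ι : PadicAlgCl ℓ ≃+* ℂ) (σ : Literature.NumberTheory.GaloisRepresentations.FramedGaloisRep L (PadicAlgCl ℓ) m), σ.toGaloisRep.IsIrreducible → ((∀ᶠ v : IsDedekindDomain.HeightOneSpectrum (NumberField.RingOfIntegers L) in cofinite, σ.IsUnramifiedAt v) ∧ ∀ (v : IsDedekindDomain.HeightOneSpectrum (NumberField.RingOfIntegers L)) (hv : ((ℓ : ℕ) : NumberField.RingOfIntegers L) ∈ v.asIdeal), (Literature.NumberTheory.PAdicHodge.fontainePstAdicCompletion v ℓ hv).IsDeRhamFramed (σ.toLocal v)) → (∀ (v : IsDedekindDomain.HeightOneSpectrum (NumberField.RingOfIntegers L)) (hv : ((ℓ : ℕ) : NumberField.RingOfIntegers L) ∈ v.asIdeal), (Literature.NumberTheory.PAdicHodge.fontainePstAdicCompletion v ℓ hv).IsCrystallineFramed (σ.toLocal v)) → (∀ w : IsDedekindDomain.HeightOneSpectrum (NumberField.RingOfIntegers L),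 ((ℓ : ℕ) : NumberField.RingOfIntegers L) ∉ w.asIdeal → σ.IsUnramifiedAt w) → ∀ (ι₂ : PadicAlgCl 2 ≃+* ℂ), ∃ σ₂ : Literature.NumberTheory.GaloisRepresentations.FramedGaloisRep L (PadicAlgCl 2) m, (∀ᶠ v : IsDedekindDomain.HeightOneSpectrum (NumberField.RingOfIntegers L) in cofinite, σ₂.IsUnramifiedAt v) ∧ (∀ᶠ v : IsDedekindDomain.HeightOneSpectrum (NumberField.RingOfIntegers L) in cofinite, ∃ α : Multiset ℂ, σ.HasFrobCharpolyAt v (Literature.NumberTheory.Automorphic.arithFrobPolyOfSatake ι v.residueCard 1 α) ∧ σ₂.HasFrobCharpolyAt v (Literature.NumberTheory.Automorphic.arithFrobPolyOfSatake ι₂ v.residueCard 1 α)) := by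
    intro m
    induction m using Nat.strong_induction_on with
    | _ n ih =>
      intro K _ _ hn ℓ _ hℓ ι ρ hirr hgeo hcrys hlvl ι₂
      by_cases hLie : ∀ (L' : Type) [Field L'] [NumberField L'] [Algebra K L'], (ρ.restrictField L').toGaloisRep.IsIrreducible
      · exact hR K n hn ℓ hℓ ι ρ hirr hLie hgeo hcrys hlvl ι₂
      · rcases hC K n hn ℓ hℓ ρ hirr hgeo hcrys hlvl hLie with
          ⟨L₁, _, _, _, d, m, hd, hdm, _, V₁, hV₁irr, hV₁geo, hV₁crys, hV₁lvl, htransport⟩ |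
          ⟨m, a, ha, ham, σ, τ, hσirr, hσgeo, hσpot, hfin, hkron⟩
        · have hm0 : 0 < m := Nat.pos_of_ne_zero (by rintro rfl; simp at hdm; omega)
          have hmn : m < n :=
            calc m < 2 * m := by omega
              _ ≤ d * m := Nat.mul_le_mul_right m hd
              _ = n := hdm
          exact htransport ι ι₂ (ih m hmn L₁ hm0 ℓ hℓ ι V₁ hV₁irr hV₁geo hV₁crys hV₁lvl ι₂)
        · exact hF K n hn ℓ hℓ ι ρ hirr hgeo hcrys hlvl m a ha ham σ τ hσirr hσgeo hσpot hfin hkron ih ι₂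
  -- E from T and G (the g8 glue, two lines)
  intro K _ _ n hn ℓ _ hℓ2 ι ρ hirr hgeo hcrys hlev ι₂
  obtain ⟨ρ₂, hur₂, hm⟩ := hT n K hn ℓ hℓ2 ι ρ hirr hgeo hcrys hlev ι₂
  exact ⟨ρ₂, ⟨hur₂, hG K n hn ℓ hℓ2 ι ρ hirr hgeo hcrys hlev ι₂ ρ₂ hur₂ hm⟩, hm⟩

/-- The glue item of the k = 4β resplit of `DyadicCompanionSplit.DyadicCompanionExistence`. -/
theorem DyadicCompanionExistence_of_resplit_proof :
    Summit.Langlands.Langlands.Theses.DyadicCompanionSplit.DyadicCompanionExistence_of_resplit := by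
  intro h₁ h₂ h₃ h₄
  apply dyadicCompanionExistence_of_cells <;> assumption

end Summit.Langlands.Langlands.Theorems.DyadicCompanionSplitResplit4b
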